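import Summits.QuantumFields.YangMills.Theorems.UnitScaleTiltProp7SymFrameCovDefs
import HarnessLib

/-!
# Route `UnitScaleTilt`, crux K1 child «MinimiserStabilityRegPr» (stmt-QuantumFields-19200), stub `stub_existenceMinimalOrbit` (EX), the (R) reality rows of the EX knit
# (ym-inputs-p03 g2 memo #51 `REALITY-ROWS-LOCATE-p03g2.md` §3 (Q-b)) — **THE EXP-MEAN-LOG TOWER IS EQUIVARIANT UNDER CENTRAL RESCALING** (generic part): for a
# scalar bond field `φ : PBond → ℂˣ` read in the centre of `𝔸` (`ι = algebraMap ℂ 𝔸`), the (0.4) average, the symmetric covariant frames (82), the covariant double bar (89)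
# and its tower (127)∕(150) of the field `(ιφ)·U₀` relative to the background `U₀` FACTOR as «the SAME construction on `φ` at `𝔸 = ℂ`» times «the construction on `U₀`»
# — because a central factor passes through every holonomy (9), through `log`∕`exp` of commuting small elements ((21), `log(zY) = log z + log Y`), and CANCELS EXACTLY in
# every twisted stair transporter (58) `W(Γ)U₀(Γ)⁻¹`.

Cell `ym3-torus`, width seat `ym-ust-20520-w5` (gen 5; the `QTwS`∕`dbarTwS` lineage).  `--supports stmt-QuantumFields-19200 --as helper`; THEOREMS ONLY (0 `def`, 0 `sorry`);
count-neutral; nothing here claims the stub, the crux, d = 4 or the mass gap — YM₃ on T³ is a ladder rung (R3), not the Clay problem.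

WHY (memo #51 §3).  ym-inputs-p01's Hilbert carriers are `M₂(ℂ) = 𝔰𝔩(2,ℂ) ⊕ ℂ·1`-valued; the reality rows `hH₁R`∕(R-H)∕`hA₁R` of the EX knit v2.9ˢ need the averaging operator
`Q(U₀) = QTwS U₀` ON THE SCALAR SECTOR `ℂ·1` (both `Q∘σ = σ∘Q` and `Q(scalar) ⊆ scalar` live there); (Q-a) (`𝔰𝔲(2) → 𝔰𝔲(2)`) is in the tree, (Q-b) is the T³ sibling file
`…Prop7QTwSScalarSector`, which reads THIS file's tower identity at `W := U₀♭`, `φ := e^{s}`.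

WHAT IS PROVED (any complete normed ℂ-algebra `𝔸` with `‖1‖ = 1`, any `Params`; `ιˣ := Units.map (algebraMap ℂ 𝔸)`; smallness = «within `1∕8` of `1`»):
* §1 `mlog_algebraMap_mul` (`log(ιz·Y) = ι(log z) + log Y` for `‖z − 1‖, ‖Y − 1‖ ≤ 1∕8`, by `exp`-injectivity below `log 2`), `eml_algebraMap_mul` (`eml (ιzᵢ·Yᵢ) = ι(eml z)·eml Y`),
  `eml_algebraMap` (`eml (ιzᵢ) = ι(eml z)`, `‖zᵢ − 1‖ < 1`), `holT_centralMul` (`((ιφ)·W)(Γ) = ι(φ(Γ))·W(Γ)`, exact).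
* §2 one level: `loopHolU_centralMul` (exact), ★`emlAvgU_centralMul` ((0.4): `\overline{(ιφ)·W}(c) = ι(φ̄(c))·W̄(c)` when the loop variables of `W` and of `φ` at `c` are
  `1∕8`-small), ★`tstairU_centralMul_self` ((58): `tstairU U₀ ((ιφ)·U₀) = ι(φ(stair))`, EXACT), `vframeCovU_centralMul_self` ((82): the covariant frame of `(ιφ)·U₀` against `U₀` is
  the scalar frame `ι(vframeU φ)`), `dbarCovU_centralMul_self` ((89)).
* §3 the tower: ★★`dbarCovIterU_centralMul_self` and `frameAccU_centralMul_self` — `dbarCovIterU k U₀ ((ιφ)·U₀) = (ι ∘ dbarIterU k φ)·Ū₀^{(k)}` and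
  `frameAccU k U₀ ((ιφ)·U₀) = ι ∘ frameAccU k 1 φ`, under the DISPLAYED smallness of the (0.4) loop variables of every background iterate `Ū₀ʲ`, `j < k` (gauge-INVARIANT;
  at a printed-regular background a consequence of plaquette smallness — the T³ sibling) and of the scalar tower `dbarIterU j φ` and its stairs.
HONEST SCOPE.  Banach-algebra bookkeeping over the cell's own letters; no estimate beyond the displayed `1∕8`-windows; nothing of [Balaban1985Averaging] is asserted.

References: T. Bałaban, CMP **98** (1985) 17–51 [Balaban1985Averaging] ((8)–(9), (11) p.19, (21)–(26) p.22, (58) p.27, (82) p.30, (89)–(92) p.31, (97) p.32, (127) p.36);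
CMP **109** (1987) 249–301 [Balaban1987RG1] ((0.4), (0.6)–(0.7), (0.11) p.253).
-/

set_option autoImplicit false

noncomputable section

namespace Summit.QuantumFields.YangMills.Theorems.Prop7SymAvgTwSym

open NormedSpace
open Literature.MathematicalPhysics.QuantumFieldTheory.Balaban1983to89
open T4Continuum BlockAveraging ExpMeanLog MatrixLog
open B7BlockAvgLog (mlog_exp commute_mlog_right)
open Literature.Analysis.Complex (logSeriesCoeff)
open B10Eq27TorusAxialLog (holT holT_nil holT_cons_true holT_cons_false holT_one gaugeActT gaugeActT_apply)
open Summit.QuantumFields.YangMills.Theorems.Prop8Chart (loopHolU emlAvgU coe_emlAvgU emlIterU emlIterU_succ emlIterU_zero emlIterU_one eml_const_one)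
open Summit.QuantumFields.YangMills.Theorems.Prop8ChartDoubleBar (vframeU coe_vframeU dbarAvgU dbarAvgU_eq_gaugeActT dbarIterU dbarIterU_succ dbarIterU_zero)

variable {𝔸 : Type*} [NormedRing 𝔸] [NormOneClass 𝔸] [NormedAlgebra ℂ 𝔸] [CompleteSpace 𝔸]

/-! ## §1 The centre: `log` and `exp[mean log]` of central multiples; holonomies of centrally rescaled fields -/

section Centre

omit [CompleteSpace 𝔸] in
/-- `‖ι z‖ = ‖z‖` and `‖ι z − 1‖ = ‖z − 1‖` for the unital embedding `ι = algebraMap ℂ 𝔸` (`‖1‖ = 1`). [folklore] -/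
theorem norm_algebraMap_sub_one (z : ℂ) : ‖algebraMap ℂ 𝔸 z - 1‖ = ‖z - 1‖ := by
  rw [← map_one (algebraMap ℂ 𝔸), ← map_sub, norm_algebraMap']

omit [NormOneClass 𝔸] [CompleteSpace 𝔸] in
/-- a central element commutes with everything. [folklore] -/
theorem commute_algebraMap (z : ℂ) (Y : 𝔸) : Commute (algebraMap ℂ 𝔸 z) Y := Algebra.commutes z Y

/-- **`log (ι z · Y) = ι (log z) + log Y` FOR A CENTRAL SMALL FACTOR** (`‖z − 1‖, ‖Y − 1‖ ≤ 1∕8`): both sides have norm `< log 2` and the same exponential `ι z · Y`, and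
`log ∘ exp = id` below `log 2` ([Balaban1985Averaging] (21)∕(26), ✓`B7BlockAvgLog.mlog_exp`). [cite: Balaban1985Averaging, (21)-(26) p.22] -/
theorem mlog_algebraMap_mul {z : ℂ} {Y : 𝔸} (hz : ‖z - 1‖ ≤ 1 / 8) (hY : ‖Y - 1‖ ≤ 1 / 8) :
    mlog (algebraMap ℂ 𝔸 z * Y) = algebraMap ℂ 𝔸 (mlog z) + mlog Y := by
  letI : NormedAlgebra ℚ 𝔸 := NormedAlgebra.restrictScalars ℚ ℂ 𝔸
  have hlog2 := Real.log_two_gt_d9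
  -- the candidate logarithm `C := ι(log z) + log Y` is `< log 2`
  have hz1 : ‖z - 1‖ < 1 := hz.trans_lt (by norm_num)
  have hY1 : ‖Y - 1‖ < 1 := hY.trans_lt (by norm_num)
  have hnz : ‖mlog z‖ ≤ 2 * ‖z - 1‖ := norm_mlog_le_two_mul (hz.trans (by norm_num))
  have hnY : ‖mlog Y‖ ≤ 2 * ‖Y - 1‖ := norm_mlog_le_two_mul (hY.trans (by norm_num))
  have hC : ‖algebraMap ℂ 𝔸 (mlog z) + mlog Y‖ < Real.log 2 := by
    refine (norm_add_le _ _).trans_lt ?_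
    rw [norm_algebraMap']
    linarith
  -- its exponential is `ι z · Y`
  have hexp : exp (algebraMap ℂ 𝔸 (mlog z) + mlog Y) = algebraMap ℂ 𝔸 z * Y := by
    rw [exp_add_of_commute (commute_algebraMap (mlog z) (mlog Y)), ← algebraMap_exp_comm (mlog z), exp_mlog hz1, exp_mlog hY1]
  rw [← hexp, mlog_exp hC]

/-- **`exp[mean log]` OF CENTRAL MULTIPLES**: `eml (ι zᵢ · Yᵢ) = ι (eml z) · eml Y` when every `‖zᵢ − 1‖, ‖Yᵢ − 1‖ ≤ 1∕8` — the (0.6)-type equivariance of the printed operation for the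
CENTRE (print states conjugations (0.6) and permutations (0.7); central factors are the abelian case of (0.6) with the scalar pulled out of the mean of logarithms).
[cite: Balaban1987RG1, (0.4) p.253, (0.6) p.253; Balaban1985Averaging, (21) p.22] -/
theorem eml_algebraMap_mul {ι : Type*} [Fintype ι] {z : ι → ℂ} {Y : ι → 𝔸} (hz : ∀ i, ‖z i - 1‖ ≤ 1 / 8) (hY : ∀ i, ‖Y i - 1‖ ≤ 1 / 8) :
    eml (fun i => algebraMap ℂ 𝔸 (z i) * Y i) = algebraMap ℂ 𝔸 (eml z) * eml Y := by
  letI : NormedAlgebra ℚ 𝔸 := NormedAlgebra.restrictScalars ℚ ℂ 𝔸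
  rw [eml_eq_exp, eml_eq_exp, eml_eq_exp]
  have hsum : ∑ i, mlog (algebraMap ℂ 𝔸 (z i) * Y i) = algebraMap ℂ 𝔸 (∑ i, mlog (z i)) + ∑ i, mlog (Y i) := by
    rw [map_sum, ← Finset.sum_add_distrib]
    exact Finset.sum_congr rfl fun i _ => mlog_algebraMap_mul (hz i) (hY i)
  rw [hsum, smul_add, exp_add_of_commute ((commute_algebraMap _ _).smul_left _ |>.smul_right _)]
  congr 1
  rw [← algebraMap_smul (A := 𝔸) ((Fintype.card ι : ℂ)⁻¹), smul_eq_mul, ← map_mul, ← smul_eq_mul, algebraMap_exp_comm]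

/-- **`exp[mean log]` OF CENTRAL ELEMENTS IS CENTRAL**: `eml (ι zᵢ) = ι (eml z)` for `‖zᵢ − 1‖ < 1` (the series (21) commutes with the continuous unital embedding termwise).
[cite: Balaban1987RG1, (0.4) p.253; Balaban1985Averaging, (21) p.22] -/
theorem eml_algebraMap {ι : Type*} [Fintype ι] {z : ι → ℂ} (hz : ∀ i, ‖z i - 1‖ < 1) :
    eml (fun i => algebraMap ℂ 𝔸 (z i)) = algebraMap ℂ 𝔸 (eml z) := by
  rw [eml_eq_exp, eml_eq_exp]
  have hlog : ∀ i, mlog (algebraMap ℂ 𝔸 (z i)) = algebraMap ℂ 𝔸 (mlog (z i)) := by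
    intro i
    have h1 := hasSum_mlog (hz i)
    have h2 : HasSum (fun n : ℕ => logSeriesCoeff n • (algebraMap ℂ 𝔸 (z i) - 1) ^ n) (algebraMap ℂ 𝔸 (mlog (z i))) := by
      have h3 := h1.mapL (Algebra.linearMap ℂ 𝔸).toContinuousLinearMap
      simp only [LinearMap.coe_toContinuousLinearMap', Algebra.linearMap_apply, map_smul, map_pow, map_sub, map_one] at h3
      exact h3
    have h4 : ‖algebraMap ℂ 𝔸 (z i) - 1‖ < 1 := by rw [norm_algebraMap_sub_one]; exact hz i
    exact (hasSum_mlog h4).unique h2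
  simp_rw [hlog]
  rw [← map_sum, ← algebraMap_smul (A := 𝔸) ((Fintype.card ι : ℂ)⁻¹), smul_eq_mul, ← map_mul, ← smul_eq_mul, algebraMap_exp_comm]


omit [NormOneClass 𝔸] [NormedAlgebra ℂ 𝔸] [CompleteSpace 𝔸] in
/-- units in the image of a central hom commute with every unit. [folklore] -/
theorem commute_unitsMap_algebraMap [NormedAlgebra ℂ 𝔸] (z : ℂˣ) (u : 𝔸ˣ) :
    Commute (Units.map ((algebraMap ℂ 𝔸 : ℂ →+* 𝔸) : ℂ →* 𝔸) z) u :=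
  Commute.units_of_val (by rw [Units.coe_map]; exact Algebra.commutes (z : ℂ) (u : 𝔸))

variable {P : Params} {j : ℕ}

omit [NormOneClass 𝔸] [CompleteSpace 𝔸] in
/-- **HOLONOMIES OF A CENTRALLY RESCALED FIELD** ((9)): `((ιφ)·W)(Γ) = ι(φ(Γ))·W(Γ)` for every word `Γ` — exact (the central factors commute past every bond variable).
[cite: Balaban1985Averaging, (9) p.19] -/
theorem holT_centralMul (φ : GaugeField P j ℂˣ) (W : GaugeField P j 𝔸ˣ) :
    ∀ (x : Site P j) (w : List (Letter P.d)),
      holT (fun b => Units.map ((algebraMap ℂ 𝔸 : ℂ →+* 𝔸) : ℂ →* 𝔸) (φ b) * W b) x w =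
        Units.map ((algebraMap ℂ 𝔸 : ℂ →+* 𝔸) : ℂ →* 𝔸) (holT φ x w) * holT W x w
  | x, [] => by rw [holT_nil, holT_nil, holT_nil, map_one, one_mul]
  | x, (μ, true) :: w => by
    rw [holT_cons_true, holT_cons_true, holT_cons_true, holT_centralMul φ W (x.shift μ) w, map_mul]
    have hc := (commute_unitsMap_algebraMap (𝔸 := 𝔸) (holT φ (x.shift μ) w) (W ⟨x, μ⟩)).eq
    calc Units.map (↑(algebraMap ℂ 𝔸)) (φ ⟨x, μ⟩) * W ⟨x, μ⟩ * (Units.map (↑(algebraMap ℂ 𝔸)) (holT φ (x.shift μ) w) * holT W (x.shift μ) w)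
        = Units.map (↑(algebraMap ℂ 𝔸)) (φ ⟨x, μ⟩) * (W ⟨x, μ⟩ * Units.map (↑(algebraMap ℂ 𝔸)) (holT φ (x.shift μ) w)) * holT W (x.shift μ) w := by
          simp only [mul_assoc]
      _ = Units.map (↑(algebraMap ℂ 𝔸)) (φ ⟨x, μ⟩) * Units.map (↑(algebraMap ℂ 𝔸)) (holT φ (x.shift μ) w) * (W ⟨x, μ⟩ * holT W (x.shift μ) w) := by
          rw [← hc]; simp only [mul_assoc]
  | x, (μ, false) :: w => by
    rw [holT_cons_false, holT_cons_false, holT_cons_false, holT_centralMul φ W (x.unshift μ) w, map_mul, map_inv, mul_inv_rev]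
    have hc := ((commute_unitsMap_algebraMap (𝔸 := 𝔸) (holT φ (x.unshift μ) w) (W ⟨x.unshift μ, μ⟩)).inv_right).eq
    have hc' := (((commute_unitsMap_algebraMap (𝔸 := 𝔸) (φ ⟨x.unshift μ, μ⟩) (W ⟨x.unshift μ, μ⟩)).inv_left).inv_right).eq
    calc (W ⟨x.unshift μ, μ⟩)⁻¹ * (Units.map (↑(algebraMap ℂ 𝔸)) (φ ⟨x.unshift μ, μ⟩))⁻¹ *
          (Units.map (↑(algebraMap ℂ 𝔸)) (holT φ (x.unshift μ) w) * holT W (x.unshift μ) w)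
        = (Units.map (↑(algebraMap ℂ 𝔸)) (φ ⟨x.unshift μ, μ⟩))⁻¹ * ((W ⟨x.unshift μ, μ⟩)⁻¹ *
          Units.map (↑(algebraMap ℂ 𝔸)) (holT φ (x.unshift μ) w)) * holT W (x.unshift μ) w := by
          rw [← hc']; simp only [mul_assoc]
      _ = (Units.map (↑(algebraMap ℂ 𝔸)) (φ ⟨x.unshift μ, μ⟩))⁻¹ * Units.map (↑(algebraMap ℂ 𝔸)) (holT φ (x.unshift μ) w) *
          ((W ⟨x.unshift μ, μ⟩)⁻¹ * holT W (x.unshift μ) w) := by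
          rw [← hc]; simp only [mul_assoc]

end Centre

/-! ## §2 One level: the (0.4) average, the twisted stairs (58), the covariant frame (82) and double bar (89) of a centrally rescaled field -/

section OneLevel

variable {P : Params} {j : ℕ}

omit [NormOneClass 𝔸] [CompleteSpace 𝔸] in
/-- the (0.4) loop variables of `(ιφ)·W` factor exactly. [cite: Balaban1987RG1, (0.4) p.253] -/
theorem loopHolU_centralMul (φ : GaugeField P j ℂˣ) (W : GaugeField P j 𝔸ˣ) (c : PBond P (j + 1)) (i : Idx P) :
    loopHolU (fun b => Units.map ((algebraMap ℂ 𝔸 : ℂ →+* 𝔸) : ℂ →* 𝔸) (φ b) * W b) c i =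
      Units.map ((algebraMap ℂ 𝔸 : ℂ →+* 𝔸) : ℂ →* 𝔸) (loopHolU φ c i) * loopHolU W c i := by
  unfold loopHolU
  exact holT_centralMul φ W _ _

/-- ★ **THE (0.4) AVERAGE OF A CENTRALLY RESCALED FIELD**: `\overline{(ιφ)·W}(c) = ι(φ̄(c))·W̄(c)` — with `φ̄` the SAME unguarded (0.4) average at `𝔸 = ℂ` — whenever the loop
variables of `W` and of `φ` at `c` are within `1∕8` of `1` (the straight transporters factor exactly, the `exp[mean log]` of the loops by `eml_algebraMap_mul`).
[cite: Balaban1987RG1, (0.4) p.253, (0.6) p.253] -/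
theorem emlAvgU_centralMul (φ : GaugeField P j ℂˣ) (W : GaugeField P j 𝔸ˣ) (c : PBond P (j + 1))
    (hW : ∀ i : Idx P, ‖((loopHolU W c i : 𝔸ˣ) : 𝔸) - 1‖ ≤ 1 / 8) (hφ : ∀ i : Idx P, ‖((loopHolU φ c i : ℂˣ) : ℂ) - 1‖ ≤ 1 / 8) :
    emlAvgU (fun b => Units.map ((algebraMap ℂ 𝔸 : ℂ →+* 𝔸) : ℂ →* 𝔸) (φ b) * W b) c =
      Units.map ((algebraMap ℂ 𝔸 : ℂ →+* 𝔸) : ℂ →* 𝔸) (emlAvgU φ c) * emlAvgU W c := by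
  apply Units.ext
  rw [coe_emlAvgU, Units.val_mul, Units.coe_map, coe_emlAvgU, coe_emlAvgU, holT_centralMul, Units.val_mul, Units.coe_map]
  have hfam : (fun i : Idx P => ((loopHolU (fun b => Units.map ((algebraMap ℂ 𝔸 : ℂ →+* 𝔸) : ℂ →* 𝔸) (φ b) * W b) c i : 𝔸ˣ) : 𝔸)) =
      fun i : Idx P => algebraMap ℂ 𝔸 ((loopHolU φ c i : ℂˣ) : ℂ) * ((loopHolU W c i : 𝔸ˣ) : 𝔸) := by
    funext i
    rw [loopHolU_centralMul, Units.val_mul, Units.coe_map]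
    rfl
  rw [hfam, eml_algebraMap_mul hφ hW]
  simp only [MonoidHom.coe_coe, map_mul]
  have hc := (commute_algebraMap (𝔸 := 𝔸) ((holT φ (emb c.src) (List.replicate P.L (c.dir, true)) : ℂˣ) : ℂ)
    (eml fun i : Idx P => ((loopHolU W c i : 𝔸ˣ) : 𝔸))).eq
  calc algebraMap ℂ 𝔸 (eml fun i => ((loopHolU φ c i : ℂˣ) : ℂ)) * eml (fun i => ((loopHolU W c i : 𝔸ˣ) : 𝔸)) *
        (algebraMap ℂ 𝔸 ((holT φ (emb c.src) (List.replicate P.L (c.dir, true)) : ℂˣ) : ℂ) *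
          ((holT W (emb c.src) (List.replicate P.L (c.dir, true)) : 𝔸ˣ) : 𝔸))
      = algebraMap ℂ 𝔸 (eml fun i => ((loopHolU φ c i : ℂˣ) : ℂ)) * (eml (fun i => ((loopHolU W c i : 𝔸ˣ) : 𝔸)) *
        algebraMap ℂ 𝔸 ((holT φ (emb c.src) (List.replicate P.L (c.dir, true)) : ℂˣ) : ℂ)) *
          ((holT W (emb c.src) (List.replicate P.L (c.dir, true)) : 𝔸ˣ) : 𝔸) := by simp only [mul_assoc]
    _ = _ := by rw [← hc]; simp only [mul_assoc]

omit [NormOneClass 𝔸] [CompleteSpace 𝔸] in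
/-- ★ **THE TWISTED STAIR TRANSPORTERS (58) OF `(ιφ)·U₀` AGAINST `U₀` ARE PURE SCALARS — EXACTLY**: `((ιφ)U₀)(Γ)·U₀(Γ)⁻¹ = ι(φ(Γ))` (the matrix parts cancel; no smallness).
[cite: Balaban1985Averaging, (58) p.27] -/
theorem tstairU_centralMul_self (φ : GaugeField P j ℂˣ) (U₀ : GaugeField P j 𝔸ˣ) (y : Site P (j + 1)) (i : Idx P) :
    tstairU U₀ (fun b => Units.map ((algebraMap ℂ 𝔸 : ℂ →+* 𝔸) : ℂ →* 𝔸) (φ b) * U₀ b) y i =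
      Units.map ((algebraMap ℂ 𝔸 : ℂ →+* 𝔸) : ℂ →* 𝔸) (holT φ (emb y) (stairWord i.2.1 (off i.1))) := by
  rw [tstairU_def, holT_centralMul, mul_assoc, mul_inv_cancel, mul_one]

/-- **THE COVARIANT FRAME (82) OF `(ιφ)·U₀` AGAINST `U₀` IS THE SCALAR FRAME `ι(vframeU φ)`** (stair transporters of `φ` within `1` of `1`, so that the series logarithm commutes with
`ι`). [cite: Balaban1985Averaging, (82) p.30] -/
theorem vframeCovU_centralMul_self (φ : GaugeField P j ℂˣ) (U₀ : GaugeField P j 𝔸ˣ) (y : Site P (j + 1))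
    (hφ : ∀ i : Idx P, ‖((holT φ (emb y) (stairWord i.2.1 (off i.1)) : ℂˣ) : ℂ) - 1‖ < 1) :
    vframeCovU U₀ (fun b => Units.map ((algebraMap ℂ 𝔸 : ℂ →+* 𝔸) : ℂ →* 𝔸) (φ b) * U₀ b) y =
      Units.map ((algebraMap ℂ 𝔸 : ℂ →+* 𝔸) : ℂ →* 𝔸) (vframeU φ y) := by
  apply Units.ext
  rw [coe_vframeCovU, Units.coe_map, MonoidHom.coe_coe, coe_vframeU]
  have hfam : (fun i : Idx P => ((tstairU U₀ (fun b => Units.map ((algebraMap ℂ 𝔸 : ℂ →+* 𝔸) : ℂ →* 𝔸) (φ b) * U₀ b) y i : 𝔸ˣ) : 𝔸)) =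
      fun i : Idx P => algebraMap ℂ 𝔸 ((holT φ (emb y) (stairWord i.2.1 (off i.1)) : ℂˣ) : ℂ) := by
    funext i
    rw [tstairU_centralMul_self, Units.coe_map]
    rfl
  rw [hfam, eml_algebraMap hφ]

/-- **THE COVARIANT DOUBLE BAR (89) OF `(ιφ)·U₀` AGAINST `U₀`**: `dbarCovU U₀ ((ιφ)·U₀)(c) = ι(dbarAvgU φ c)·Ū₀(c)` — the H side's double bar of the scalar field (at `𝔸 = ℂ`) times the
plain average of the background (loop variables of `U₀`, `φ` at `c` within `1∕8`, stairs of `φ` at both ends within `1`). [cite: Balaban1985Averaging, (89) p.31] -/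
theorem dbarCovU_centralMul_self (φ : GaugeField P j ℂˣ) (U₀ : GaugeField P j 𝔸ˣ) (c : PBond P (j + 1))
    (hU : ∀ i : Idx P, ‖((loopHolU U₀ c i : 𝔸ˣ) : 𝔸) - 1‖ ≤ 1 / 8) (hφ : ∀ i : Idx P, ‖((loopHolU φ c i : ℂˣ) : ℂ) - 1‖ ≤ 1 / 8)
    (hφs : ∀ i : Idx P, ‖((holT φ (emb c.src) (stairWord i.2.1 (off i.1)) : ℂˣ) : ℂ) - 1‖ < 1)
    (hφt : ∀ i : Idx P, ‖((holT φ (emb c.tgt) (stairWord i.2.1 (off i.1)) : ℂˣ) : ℂ) - 1‖ < 1) :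
    dbarCovU U₀ (fun b => Units.map ((algebraMap ℂ 𝔸 : ℂ →+* 𝔸) : ℂ →* 𝔸) (φ b) * U₀ b) c =
      Units.map ((algebraMap ℂ 𝔸 : ℂ →+* 𝔸) : ℂ →* 𝔸) (dbarAvgU φ c) * emlAvgU U₀ c := by
  rw [dbarCovU_apply, vframeCovU_centralMul_self φ U₀ c.src hφs, vframeCovU_centralMul_self φ U₀ c.tgt hφt, emlAvgU_centralMul φ U₀ c hU hφ,
    dbarAvgU_eq_gaugeActT, gaugeActT_apply, inv_inv, map_mul, map_mul, map_inv]
  have h1 := (commute_unitsMap_algebraMap (𝔸 := 𝔸) (vframeU φ c.tgt) (emlAvgU U₀ c)).eq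
  calc (Units.map (↑(algebraMap ℂ 𝔸)) (vframeU φ c.src))⁻¹ * (Units.map (↑(algebraMap ℂ 𝔸)) (emlAvgU φ c) * emlAvgU U₀ c) *
        Units.map (↑(algebraMap ℂ 𝔸)) (vframeU φ c.tgt)
      = (Units.map (↑(algebraMap ℂ 𝔸)) (vframeU φ c.src))⁻¹ * Units.map (↑(algebraMap ℂ 𝔸)) (emlAvgU φ c) *
        (emlAvgU U₀ c * Units.map (↑(algebraMap ℂ 𝔸)) (vframeU φ c.tgt)) := by simp only [mul_assoc]
    _ = _ := by rw [← h1]; simp only [mul_assoc]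

end OneLevel

/-! ## §3 The tower (127)∕(150) and the accumulated frames (97) of a centrally rescaled background -/

section Tower

variable {P : Params}

/-- ★★ **THE COVARIANT TOWER OF `(ιφ)·U₀` AGAINST `U₀` FACTORS**: `dbarCovIterU k U₀ ((ιφ)·U₀) = (ι ∘ U̿^{(k)}(φ))·Ū₀^{(k)}` and `frameAccU k U₀ ((ιφ)·U₀) = ι ∘ frameAccU k 1 φ`
(the scalar tower is the H side's double-bar tower `dbarIterU` of `φ` at `𝔸 = ℂ`, i.e. the covariant tower at background `1`), PROVIDED at every level `j < k` the (0.4) loop variables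
of the background iterate `Ū₀ʲ` and of the scalar iterate `U̿^{(j)}(φ)` are within `1∕8` of `1` and the stair transporters of `U̿^{(j)}(φ)` within `1` — displayed; the background
clause is GAUGE-INVARIANT (plaquette smallness of a printed-regular background, the T³ sibling). [cite: Balaban1985Averaging, (97) p.32, (127) p.36, (150) p.40] -/
theorem dbarCovIterU_centralMul_self (φ : GaugeField P 0 ℂˣ) (U₀ : GaugeField P 0 𝔸ˣ) :
    ∀ k : ℕ,
      (∀ j, j < k → ∀ (c : PBond P (j + 1)) (i : Idx P), ‖((loopHolU (emlIterU j U₀) c i : 𝔸ˣ) : 𝔸) - 1‖ ≤ 1 / 8) →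
      (∀ j, j < k → ∀ (c : PBond P (j + 1)) (i : Idx P), ‖((loopHolU (dbarIterU j φ) c i : ℂˣ) : ℂ) - 1‖ ≤ 1 / 8) →
      (∀ j, j < k → ∀ (y : Site P (j + 1)) (i : Idx P), ‖((holT (dbarIterU j φ) (emb y) (stairWord i.2.1 (off i.1)) : ℂˣ) : ℂ) - 1‖ < 1) →
      dbarCovIterU k U₀ (fun b => Units.map ((algebraMap ℂ 𝔸 : ℂ →+* 𝔸) : ℂ →* 𝔸) (φ b) * U₀ b) =
          (fun e => Units.map ((algebraMap ℂ 𝔸 : ℂ →+* 𝔸) : ℂ →* 𝔸) (dbarIterU k φ e) * emlIterU k U₀ e) ∧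
        ∀ y : Site P k, frameAccU k U₀ (fun b => Units.map ((algebraMap ℂ 𝔸 : ℂ →+* 𝔸) : ℂ →* 𝔸) (φ b) * U₀ b) y =
          Units.map ((algebraMap ℂ 𝔸 : ℂ →+* 𝔸) : ℂ →* 𝔸) (frameAccU k (fun _ : PBond P 0 => (1 : ℂˣ)) φ y)
  | 0 => fun _ _ _ => by
    refine ⟨?_, fun y => ?_⟩
    · funext e
      rw [dbarCovIterU_zero, dbarIterU_zero, emlIterU_zero]
    · rw [frameAccU_zero, frameAccU_zero, map_one]
  | k + 1 => fun hU hφ hφs => by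
    obtain ⟨hk, hfr⟩ := dbarCovIterU_centralMul_self φ U₀ k (fun j hj => hU j (by omega)) (fun j hj => hφ j (by omega)) (fun j hj => hφs j (by omega))
    have hstep : ∀ c : PBond P (k + 1), dbarCovU (emlIterU k U₀) (dbarCovIterU k U₀ (fun b => Units.map ((algebraMap ℂ 𝔸 : ℂ →+* 𝔸) : ℂ →* 𝔸) (φ b) * U₀ b)) c =
        Units.map ((algebraMap ℂ 𝔸 : ℂ →+* 𝔸) : ℂ →* 𝔸) (dbarAvgU (dbarIterU k φ) c) * emlAvgU (emlIterU k U₀) c := by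
      intro c
      rw [hk]
      exact dbarCovU_centralMul_self (dbarIterU k φ) (emlIterU k U₀) c (hU k (by omega) c) (hφ k (by omega) c) (hφs k (by omega) c.src) (hφs k (by omega) c.tgt)
    refine ⟨?_, fun y => ?_⟩
    · funext e
      rw [dbarCovIterU_succ, hstep e, dbarIterU_succ, emlIterU_succ]
    · rw [frameAccU_succ, hfr (emb y), hk, vframeCovU_centralMul_self (dbarIterU k φ) (emlIterU k U₀) y (hφs k (by omega) y), ← map_mul,
        frameAccU_one_succ]

end Tower

end Summit.QuantumFields.YangMills.Theorems.Prop7SymAvgTwSym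

end
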